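import Summits.AtomisticToContinuum.Crystallization.Theses.IsometryAtoms
import Summits.AtomisticToContinuum.Crystallization.Theses.PerronTransitivity
import Summits.AtomisticToContinuum.Crystallization.Theorems.IsometryAtomsMinimisingLawsHaveAtomsWeightedClusterIneq
import Summits.AtomisticToContinuum.Crystallization.Theorems.IsometryAtomsMinimisingLawsHaveAtomsAllSitesOfRoot
import Summits.AtomisticToContinuum.Crystallization.Theorems.IsometryAtomsMinimisingLawsHaveAtomsPalmCopositivity
import Summits.AtomisticToContinuum.Crystallization.Theorems.IsometryAtomsMinimisingLawsHaveAtomsRootEnergyLeOfCopositivity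

/-!
# Line `perron_transfer` — crux `IsometryAtoms.MinimisingLawsHaveAtoms` (PURITY, stmt-AtomisticToContinuum-15776)
# through the copositive floor K* and the minimax rigidity M* of route `PerronTransitivity`

Strategist ALT line (planner `cstrat-stmt-AtomisticToContinuum-15776-s2`, 2026-08-17; lens TRANSFER at crux
level, second sibling). RESHAPED by the continuation lead `prover-line-stmt-AtomisticToContinuum-15776-c1-0`
(2026-08-17T18:20Z): the bridge `stub_palmEnergyTransitive` is now a sorry-free composition of four registered
worker-sized stubs 2a–2d (see §2); nothing else changed. Registered NEXT TO the live skeleton `Lines/IdeatorOneSketch.lean` (lead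
prover-line-…-15776-0; one open stub S6 `stub_strictCalibrationHcp`, certified ≥ conjunct (i) of the summit,
p167909) and to `Lines/hcp_transfer.lean` (9225 ∧ 9226 ⇒ crux; its glue is now LANDED as
`Theorems/IsometryAtomsMinimisingLawsHaveAtomsSplit.lean`, p169470). It shares NO stub with either.

THE CRUX (verbatim the route decl): every minimising (`E_P[h] ≤ e*`) point-stationary `δ`-hard-core probability
law `P` on rooted configurations of `ℝ³` charges the exact rooted isometry class of ONE set `Y ⊂ ℝ³`.

THE LINE (why it dodges the STUCK goal of the live line). The live line needs ONE dual object doing two jobs at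
once — a finite-hop Mecke calibration that is (i) a lower bound AND (ii) strict exactly at relaxed hcp; the lead's
diagnosis (crux `NOTES.md`, `Disproof.lean` Part IV) is that (ii) makes it summit-hard⁺ (it certifies hcp < every
Bravais lattice). Route `PerronTransitivity` separates the two jobs into objects that are each attacked on their
own and never name hcp: the COPOSITIVE FLOOR K* (`NoFractionalGain`, stmt-15098: the quadratic form
`Σ_{i≠j} c_i c_j V(x_i−x_j) − 2e*Σ c_i²` is copositive on every finite configuration) and the MINIMAX RIGIDITY M*
(`UniformBindingRigidity`, stmt-15099: a uniformly discrete set every site of which is bound by at least `2|e*|`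
is the point set of an optimal periodic configuration). The transfer to the Palm crux needs one genuinely new
lemma, the BRIDGE (stub 2): for a minimising point-stationary law, K* forces a.s. ENERGY-TRANSITIVITY — every
site of the sample has site energy `≤ 2e*` (in fact `= 2e*`). Mechanism (provable with LANDED machinery, see
stub 2): the weighted cluster inequality K* with weights `c_y = 1 + ε f(θ_y μ)` is pushed through the
ball-centre mass transport of the landed 9229 proof (`UnimodularEnergy.lintegral_mass_transport_ball`, the
device that turns Palm expectations into ball averages WITHOUT an ergodic theorem); zeroth order in `ε` is
`E_P[h] = e*` (landed `eStar_le_integral_rootEnergy` + minimising), so the first-order term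
`2 E_P[f·(u − 2e*)]` must vanish for every bounded local `f ≥ 0`, i.e. `u(root) = 2e*` a.s., and "root a.s. ⇒
every site a.s." (landed re-rooting device of 9228). Then M* makes almost every sample the point set of an
OPTIMAL periodic configuration through the root, and ISOLATION (stub 4 = the birth line's
`stub_minimisingCrystalsCountable`, verbatim: optimal periodic point sets are countably many modulo isometry)
puts almost all of `P` on countably many rooted classes, one of which is charged (Cantor–Bendixson seam,
proved below).

REGISTERED STUBS (sorry only here; 7 — the bridge is split into 2a–2d by the continuation lead c1, 2026-08-17):
* `stub_noFractionalGain` = `PerronTransitivity.NoFractionalGain` (stmt-AtomisticToContinuum-15098) VERBATIM —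
  shared, staffed there (lead + cdisprove; Disproof cycle 1: no kill, certification barrier on e*). XL, open.
* THE BRIDGE `stub_palmEnergyTransitive` (K* ⇒ a.s. sitewise `2e*`-binding of minimising point-stationary laws;
  the law-level twin of the proved finite `FractionalGainGivesTransitivity`, stmt-15101) is now a sorry-free
  COMPOSITION of four registered worker-sized stubs: `stub_weightedClusterIneq` (2a, weighted cluster
  inequality ← K*), `stub_palmCopositivity` (2b, ball-centre transport of 9229 with weights),
  `stub_rootEnergyLeOfCopositivity` (2c, first variation ⇒ `h ≤ e*` a.s.), `stub_allSitesOfRoot` (2d, re-rooting).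
* `stub_uniformBindingRigidity` = `PerronTransitivity.UniformBindingRigidity` (stmt-AtomisticToContinuum-15099)
  VERBATIM — shared, staffed there (lead c2, skeleton rev 4; three Negative lemmas on strengthenings). XL, open.
* `stub_minimisingCrystalsCountable` = birth line stub 3 VERBATIM (isolation of the periodic optimum modulo
  isometry; open in general — inside the hcp family it is the landed `tube_hcpE_unique_minimiser`; NECESSARY for
  the crux: a continuum of pairwise non-isometric optimal periodic configurations fed to the disprover's
  `familyLaw` machine (Disproof Part II) is a diffuse minimising law).

COMPOSITION `MinimisingLawsHaveAtoms_of` (sorry-free, concludes the route decl BY NAME): bridge (fed with K*) ⇒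
a.s. `μ = count|S`, `0 ∈ S`, `S` δ-separated and uniformly `2e*`-bound ⇒ (M*) `S = Q.points`, `Q` optimal
(`IsLeast ⇒ e(Q) = ⨅`, `le_ciInf`/`ciInf_le`) ⇒ (stub 4) `S = B '' Yₙ + t`; `0 ∈ S` gives `t = −B q` with
`q ∈ Yₙ`, so `μ = count|((B(· − q)) '' Yₙ) ∈ cl(Yₙ)`; a probability outer measure a.e. carried by `⋃ₙ cl(Yₙ)`
charges one `cl(Yₙ)` (`exists_pos_measure_of_ae_mem_iUnion`).

DISPROOF USED (`Cruxes/MinimisingLawsHaveAtoms/Disproof.lean`, cdisprove cycle 1, read 2026-08-17T15:45Z):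
`_false_without_hardCore` — honoured at stub 2 (δ-separation of the sample is OUTPUT of the bridge and INPUT of
M*'s uniform discreteness) ; `_false_without_minimising` — honoured at stub 2 (zeroth-order term `E_P[h] = e*`);
`_false_without_probability` — honoured in the composition (`IsProbabilityMeasure` in the countable-union seam)
and at stub 2 (normalised Mecke averaging); point-stationarity — consumed at stub 2 (transport identity, twice).
Part IV (S6 ⇒ hcp beats every lattice) is exactly what this line AVOIDS: no stub names hcp or certifies a
lattice comparison; the comparison content sits inside K* (value of e*) and M*, where it is attacked by the
sibling's own lines. No stub is an instance of a landed Negative lemma (UniformBindingRigidity/Negative/* refute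
depth-zero / half-space STRENGTHENINGS of M*, not M*).

CALIBRATION (no stub gives the crux or the summit on its own): K* is a finite-configuration inequality (no law,
no structure); the bridge is conditional on K* and yields no periodicity; M* speaks of no law and needs uniform
binding, which only the bridge supplies; stub 4 speaks of no law. Probes: strategist folder `bc/perron_*.lean`.
-/

noncomputable section

namespace Summit.AtomisticToContinuum.Crystallization.Cruxes.MinimisingLawsHaveAtoms.PerronTransfer

open MeasureTheory Set
open Literature.MathematicalPhysics.StatisticalMechanics Literature.Probability.Process
open Summit.AtomisticToContinuum.Crystallization.Theses.IsometryAtoms (MinimisingLawsHaveAtoms)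
open Summit.AtomisticToContinuum.Crystallization.Theses.PerronTransitivity (NoFractionalGain UniformBindingRigidity)

/-! ## §1 Vocabulary (readability only) -/

/-- The rooted isometry class of `Y ⊂ ℝ³` — verbatim the event of the crux. -/
def rootedClass (Y : Set (EuclideanSpace ℝ (Fin 3))) : Set (Measure (EuclideanSpace ℝ (Fin 3))) :=
  {μ | ∃ A : EuclideanSpace ℝ (Fin 3) →ₗᵢ[ℝ] EuclideanSpace ℝ (Fin 3), ∃ q ∈ Y,
    μ = (Measure.count : Measure (EuclideanSpace ℝ (Fin 3))).restrict ((fun s => A (s - q)) '' Y)}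

/-- `e* = ⨅_Q e(Q)`. -/
def eStar : ℝ := ⨅ Q : PeriodicConfiguration 3, Q.energyPerParticle lennardJones

/-! ## §2 The registered stubs (`sorry` lives only in stubs 1, 3, 4 — the sibling items K*, M* and isolation;
the bridge pieces 2a–2d are LANDED: p172476, p172647, p172720, p172481) -/

/-- **STUB 1 — K*, the copositive floor** (= `PerronTransitivity.NoFractionalGain`,
stmt-AtomisticToContinuum-15098, verbatim; shared, staffed there). XL, open. -/
theorem stub_noFractionalGain :
    ∀ (N : ℕ) (x : Fin N → EuclideanSpace ℝ (Fin 3)), Function.Injective x → ∀ c : Fin N → ℝ, (∀ i, 0 ≤ c i) → 2 * (⨅ Q : Literature.MathematicalPhysics.StatisticalMechanics.PeriodicConfiguration 3, Q.energyPerParticle Literature.MathematicalPhysics.StatisticalMechanics.lennardJones) * ∑ i, c i ^ 2 ≤ ∑ i, ∑ j ∈ Finset.univ.erase i, c i * c j * Literature.MathematicalPhysics.StatisticalMechanics.lennardJones (dist (x i) (x j)) := by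
  sorry

/-- **STUB 2a — weighted cluster inequality (← K*).** For a `δ`-separated `S ⊂ ℝ³`, weights
`c : ℝ³ → [0,1]` and a ball `B = B(v,R)`, with `μ = count|S`:
`∫_B c(y) ∫ c(z) V⁻(‖z-y‖) dμ dμ ≤ ∫_B [c(y) ∫ c(z) V⁺(‖z-y‖) dμ + 2(-e*) c(y)² + c(y) ∫_{Bᶜ} c(z) V⁻(‖z-y‖) dμ] dμ`
— the weighted twin of the landed `UnimodularEnergy.setLIntegral_ball_cluster_le` (9229): the `Bᶜ` parts match, and on
the finite cluster `S ∩ B` it is `NoFractionalGain` with `c_i = c(x_i)` (diagonal terms vanish, `V(0) = 0`), split into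
positive/negative parts in `ℝ≥0∞` exactly as `UnimodularEnergy.sum_sum_ofReal_neg_lennardJones_le`. M. -/
theorem stub_weightedClusterIneq :
    Summit.AtomisticToContinuum.Crystallization.Theses.PerronTransitivity.NoFractionalGain → ∀ δ : ℝ, 0 < δ → ∀ S : Set (EuclideanSpace ℝ (Fin 3)), (∀ x ∈ S, ∀ y ∈ S, x ≠ y → δ ≤ dist x y) → ∀ c : EuclideanSpace ℝ (Fin 3) → ENNReal, (∀ x, c x ≤ 1) → ∀ (v : EuclideanSpace ℝ (Fin 3)) (R : ℝ), ∫⁻ y in Metric.ball v R, c y * (∫⁻ z, c z * ENNReal.ofReal (-Literature.MathematicalPhysics.StatisticalMechanics.lennardJones ‖z - y‖) ∂((MeasureTheory.Measure.count : MeasureTheory.Measure (EuclideanSpace ℝ (Fin 3))).restrict S)) ∂((MeasureTheory.Measure.count : MeasureTheory.Measure (EuclideanSpace ℝ (Fin 3))).restrict S) ≤ ∫⁻ y in Metric.ball v R, (c y * (∫⁻ z, c z * ENNReal.ofReal (Literature.MathematicalPhysics.StatisticalMechanics.lennardJones ‖z - y‖) ∂((MeasureTheory.Measure.count : MeasureTheory.Measure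 (EuclideanSpace ℝ (Fin 3))).restrict S)) + 2 * ENNReal.ofReal (-(⨅ Q : Literature.MathematicalPhysics.StatisticalMechanics.PeriodicConfiguration 3, Q.energyPerParticle Literature.MathematicalPhysics.StatisticalMechanics.lennardJones)) * (c y) ^ 2 + c y * (∫⁻ z in (Metric.ball v R)ᶜ, c z * ENNReal.ofReal (-Literature.MathematicalPhysics.StatisticalMechanics.lennardJones ‖z - y‖) ∂((MeasureTheory.Measure.count : MeasureTheory.Measure (EuclideanSpace ℝ (Fin 3))).restrict S))) ∂((MeasureTheory.Measure.count : MeasureTheory.Measure (EuclideanSpace ℝ (Fin 3))).restrict S) := 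
  -- LANDED p172476
  Summit.AtomisticToContinuum.Crystallization.Theorems.IsometryAtomsMinimisingLawsHaveAtoms.stub_weightedClusterIneq

/-- **STUB 2b — Palm copositivity (ball-centre mass transport).** For a point-stationary probability law a.s. carried
by rooted `δ`-hard-core configurations and every measurable weight `w ≤ 1` on configurations:
`E_P[w(μ) Σ_z w(θ_z μ) V⁻(‖z‖)] ≤ E_P[w(μ) Σ_z w(θ_z μ) V⁺(‖z‖)] + 2(-e*) E_P[w²]`, `θ_z μ = μ.map (· - z)`.
Proof = the landed 9229 proof (`UnimodularEnergy.lintegral_neg_le_lintegral_pos_add`, `error_term_eq`,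
`eStar_le_integral_rootEnergy`) with the payloads multiplied by the weights: kernel `exists_kernel_eq_self`, joint
measurability of `(μ,z) ↦ w((κ μ).map (· - z))` by `Literature.Probability.Process.measurable_map_sub_kernel`, transport
`lintegral_mass_transport_ball`, received sides compared by STUB 2a with `c x = w(θ_x μ)`, error term bounded by the
UNweighted one (`w ≤ 1`) and killed by `tendsto_lintegral_lintegral_neg_lennardJones_mul`. L. -/
theorem stub_palmCopositivity :
    (∀ δ : ℝ, 0 < δ → ∀ S : Set (EuclideanSpace ℝ (Fin 3)), (∀ x ∈ S, ∀ y ∈ S, x ≠ y → δ ≤ dist x y) → ∀ c : EuclideanSpace ℝ (Fin 3) → ENNReal, (∀ x, c x ≤ 1) → ∀ (v : EuclideanSpace ℝ (Fin 3)) (R : ℝ), ∫⁻ y in Metric.ball v R, c y * (∫⁻ z, c z * ENNReal.ofReal (-Literature.MathematicalPhysics.StatisticalMechanics.lennardJones ‖z - y‖) ∂((MeasureTheory.Measure.count : MeasureTheory.Measure (EuclideanSpace ℝ (Fin 3))).restrict S)) ∂((MeasureTheory.Measure.count : MeasureTheory.Measure (EuclideanSpace ℝ (Fin 3))).restrict S)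 ≤ ∫⁻ y in Metric.ball v R, (c y * (∫⁻ z, c z * ENNReal.ofReal (Literature.MathematicalPhysics.StatisticalMechanics.lennardJones ‖z - y‖) ∂((MeasureTheory.Measure.count : MeasureTheory.Measure (EuclideanSpace ℝ (Fin 3))).restrict S)) + 2 * ENNReal.ofReal (-(⨅ Q : Literature.MathematicalPhysics.StatisticalMechanics.PeriodicConfiguration 3, Q.energyPerParticle Literature.MathematicalPhysics.StatisticalMechanics.lennardJones)) * (c y) ^ 2 + c y * (∫⁻ z in (Metric.ball v R)ᶜ, c z * ENNReal.ofReal (-Literature.MathematicalPhysics.StatisticalMechanics.lennardJones ‖z - y‖) ∂((MeasureTheory.Measure.count : MeasureTheory.Measure (EuclideanSpace ℝ (Fin 3))).restrict S))) ∂((MeasureTheory.Measure.count : MeasureTheory.Measure (EuclideanSpace ℝ (Fin 3))).restrict S)) → ∀ δ : ℝ, 0 < δ → ∀ P : MeasureTheory.Measure (MeasureTheory.Measure (EuclideanSpace ℝ (Fin 3))), MeasureTheory.IsProbabilityMeasure P → (∀ᵐ μ ∂P, Literature.Probability.Process.IsRootedHardCore δ μ) → Literature.Probability.Process.IsPointStationaryLaw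 P → ∀ w : MeasureTheory.Measure (EuclideanSpace ℝ (Fin 3)) → ENNReal, Measurable w → (∀ μ, w μ ≤ 1) → ∫⁻ μ, w μ * (∫⁻ z, w (MeasureTheory.Measure.map (fun x => x - z) μ) * ENNReal.ofReal (-Literature.MathematicalPhysics.StatisticalMechanics.lennardJones ‖z‖) ∂μ) ∂P ≤ ∫⁻ μ, w μ * (∫⁻ z, w (MeasureTheory.Measure.map (fun x => x - z) μ) * ENNReal.ofReal (Literature.MathematicalPhysics.StatisticalMechanics.lennardJones ‖z‖) ∂μ) ∂P + 2 * ENNReal.ofReal (-(⨅ Q : Literature.MathematicalPhysics.StatisticalMechanics.PeriodicConfiguration 3, Q.energyPerParticle Literature.MathematicalPhysics.StatisticalMechanics.lennardJones)) * ∫⁻ μ, (w μ) ^ 2 ∂P := 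
  -- LANDED p172647
  Summit.AtomisticToContinuum.Crystallization.Theorems.IsometryAtomsMinimisingLawsHaveAtoms.stub_palmCopositivity

/-- **STUB 2c — first variation: a.s. the root is bound by at least `2|e*|`.** For a minimising (`E_P[h] ≤ e*`)
point-stationary probability law a.s. carried by rooted `δ`-hard-core configurations, Palm copositivity (STUB 2b's
conclusion, for every measurable `w ≤ 1`) forces `h(μ) ≤ e*` almost surely. Proof: `w = 1 - s f` (`f` measurable,
`0 ≤ f ≤ 1`, `0 < s ≤ 1/2`); everything is finite on hard-core configurations (`lintegral_ofReal_(neg_)lennardJones_le`),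
so in real numbers `2e*(1 - 2sE[f] + s²E[f²]) ≤ E[u] - 2sE[fu] + s²A` after the Mecke symmetrisation
`E[Σ_z f(θ_z μ)V(‖z‖)] = E[f u]` (`u = 2h`); with `E[u] ≤ 2e*` this is `E[f(u - 2e*)] ≤ sC → 0`; take `f = 1{h' > e*}`
for the measurable version `h' = EnergyFloor.rootEnergy'` of `h`. L. -/
theorem stub_rootEnergyLeOfCopositivity :
    ∀ δ : ℝ, 0 < δ → ∀ P : MeasureTheory.Measure (MeasureTheory.Measure (EuclideanSpace ℝ (Fin 3))), MeasureTheory.IsProbabilityMeasure P → (∀ᵐ μ ∂P, Literature.Probability.Process.IsRootedHardCore δ μ) → Literature.Probability.Process.IsPointStationaryLaw P → (∫ μ, Literature.MathematicalPhysics.StatisticalMechanics.rootEnergy Literature.MathematicalPhysics.StatisticalMechanics.lennardJones μ ∂P) ≤ (⨅ Q : Literature.MathematicalPhysics.StatisticalMechanics.PeriodicConfiguration 3, Q.energyPerParticle Literature.MathematicalPhysics.StatisticalMechanics.lennardJones) → (∀ w : MeasureTheory.Measure (EuclideanSpace ℝ (Fin 3)) → ENNReal, Measurable w → (∀ μ,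 w μ ≤ 1) → ∫⁻ μ, w μ * (∫⁻ z, w (MeasureTheory.Measure.map (fun x => x - z) μ) * ENNReal.ofReal (-Literature.MathematicalPhysics.StatisticalMechanics.lennardJones ‖z‖) ∂μ) ∂P ≤ ∫⁻ μ, w μ * (∫⁻ z, w (MeasureTheory.Measure.map (fun x => x - z) μ) * ENNReal.ofReal (Literature.MathematicalPhysics.StatisticalMechanics.lennardJones ‖z‖) ∂μ) ∂P + 2 * ENNReal.ofReal (-(⨅ Q : Literature.MathematicalPhysics.StatisticalMechanics.PeriodicConfiguration 3, Q.energyPerParticle Literature.MathematicalPhysics.StatisticalMechanics.lennardJones)) * ∫⁻ μ, (w μ) ^ 2 ∂P) → ∀ᵐ μ ∂P, Literature.MathematicalPhysics.StatisticalMechanics.rootEnergy Literature.MathematicalPhysics.StatisticalMechanics.lennardJones μ ≤ (⨅ Q : Literature.MathematicalPhysics.StatisticalMechanics.PeriodicConfiguration 3, Q.energyPerParticle Literature.MathematicalPhysics.StatisticalMechanics.lennardJones) := 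
  -- LANDED p172720
  Summit.AtomisticToContinuum.Crystallization.Theorems.IsometryAtomsMinimisingLawsHaveAtoms.stub_rootEnergyLeOfCopositivity

/-- **STUB 2d — everything shows at the root.** If a point-stationary law a.s. carried by rooted `δ`-hard-core
configurations has `h(μ) ≤ e*` a.s., then a.s. EVERY site `p` of the sample `S` (`μ = count|S`) satisfies
`Σ'_{q ∈ S, q ≠ p} V(dist p q) ≤ 2e*`: re-root with `PalmUnimodularRigidity.ae_forall_map_sub_of_ae` (hard-core ⇒ locally
finite, `count_restrict_floorNorm_preimage_lt_top`), `θ_p(count|S) = count|(S - p)` (`map_sub_count_restrict`), and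
`2 h(count|(S - p)) = Σ'_{q ∈ S, q ≠ p} V(dist p q)` (`setIntegral_countable` / `integral_count_restrict_eq_tsum`,
`V(0) = 0`). M. -/
theorem stub_allSitesOfRoot :
    ∀ δ : ℝ, 0 < δ → ∀ P : MeasureTheory.Measure (MeasureTheory.Measure (EuclideanSpace ℝ (Fin 3))), (∀ᵐ μ ∂P, Literature.Probability.Process.IsRootedHardCore δ μ) → Literature.Probability.Process.IsPointStationaryLaw P → (∀ᵐ μ ∂P, Literature.MathematicalPhysics.StatisticalMechanics.rootEnergy Literature.MathematicalPhysics.StatisticalMechanics.lennardJones μ ≤ (⨅ Q : Literature.MathematicalPhysics.StatisticalMechanics.PeriodicConfiguration 3, Q.energyPerParticle Literature.MathematicalPhysics.StatisticalMechanics.lennardJones)) → ∀ᵐ μ ∂P, ∃ S : Set (EuclideanSpace ℝ (Fin 3)), (0 : EuclideanSpace ℝ (Fin 3)) ∈ S ∧ (∀ p ∈ S, ∀ q ∈ S, p ≠ q → δ ≤ dist p q) ∧ μ = (MeasureTheory.Measure.count : MeasureTheory.Measure (EuclideanSpace ℝ (Fin 3))).restrict S ∧ ∀ p ∈ S, ∑'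 q : {q : EuclideanSpace ℝ (Fin 3) // q ∈ S ∧ q ≠ p}, Literature.MathematicalPhysics.StatisticalMechanics.lennardJones (dist p q.1) ≤ 2 * ⨅ Q : Literature.MathematicalPhysics.StatisticalMechanics.PeriodicConfiguration 3, Q.energyPerParticle Literature.MathematicalPhysics.StatisticalMechanics.lennardJones := 
  -- LANDED p172481
  Summit.AtomisticToContinuum.Crystallization.Theorems.IsometryAtomsMinimisingLawsHaveAtoms.stub_allSitesOfRoot

/-- **THE BRIDGE (registered as `stub_palmEnergyTransitive`; now PROVED from STUBS 2a–2d): K* makes minimising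
point-stationary laws a.s. sitewise `2e*`-bound.** For a minimising point-stationary `δ`-hard-core probability law,
K* implies that almost surely EVERY site `p` of the sample `S` (`μ = count|S`, `0 ∈ S`) has
`Σ'_{q ∈ S, q ≠ p} V(dist p q) ≤ 2e*`. Composition: 2a (fed with K*) ⇒ 2b ⇒ 2c ⇒ 2d. -/
theorem stub_palmEnergyTransitive :
    ∀ δ : ℝ, 0 < δ → ∀ P : MeasureTheory.Measure (MeasureTheory.Measure (EuclideanSpace ℝ (Fin 3))), MeasureTheory.IsProbabilityMeasure P → (∀ᵐ μ ∂P, Literature.Probability.Process.IsRootedHardCore δ μ) → Literature.Probability.Process.IsPointStationaryLaw P → (∫ μ, Literature.MathematicalPhysics.StatisticalMechanics.rootEnergy Literature.MathematicalPhysics.StatisticalMechanics.lennardJones μ ∂P) ≤ (⨅ Q : Literature.MathematicalPhysics.StatisticalMechanics.PeriodicConfiguration 3, Q.energyPerParticle Literature.MathematicalPhysics.StatisticalMechanics.lennardJones) → Summit.AtomisticToContinuum.Crystallization.Theses.PerronTransitivity.NoFractionalGain → ∀ᵐ μ ∂P, ∃ S : Set (EuclideanSpace ℝ (Fin 3)),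 (0 : EuclideanSpace ℝ (Fin 3)) ∈ S ∧ (∀ p ∈ S, ∀ q ∈ S, p ≠ q → δ ≤ dist p q) ∧ μ = (MeasureTheory.Measure.count : MeasureTheory.Measure (EuclideanSpace ℝ (Fin 3))).restrict S ∧ ∀ p ∈ S, ∑' q : {q : EuclideanSpace ℝ (Fin 3) // q ∈ S ∧ q ≠ p}, Literature.MathematicalPhysics.StatisticalMechanics.lennardJones (dist p q.1) ≤ 2 * ⨅ Q : Literature.MathematicalPhysics.StatisticalMechanics.PeriodicConfiguration 3, Q.energyPerParticle Literature.MathematicalPhysics.StatisticalMechanics.lennardJones := by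
  intro δ hδ P hP hhc hst hE hK
  exact stub_allSitesOfRoot δ hδ P hhc hst
    (stub_rootEnergyLeOfCopositivity δ hδ P hP hhc hst hE
      (stub_palmCopositivity (stub_weightedClusterIneq hK) δ hδ P hP hhc hst))

/-- **STUB 3 — M*, minimax rigidity** (= `PerronTransitivity.UniformBindingRigidity`,
stmt-AtomisticToContinuum-15099, verbatim; shared, staffed there). XL, open. -/
theorem stub_uniformBindingRigidity :
    ∀ X : Set (EuclideanSpace ℝ (Fin 3)), X.Nonempty → (∃ δ : ℝ, 0 < δ ∧ ∀ p ∈ X, ∀ q ∈ X, p ≠ q → δ ≤ dist p q) → (∀ p ∈ X, ∑' q : {q : EuclideanSpace ℝ (Fin 3) // q ∈ X ∧ q ≠ p}, Literature.MathematicalPhysics.StatisticalMechanics.lennardJones (dist p q.1) ≤ 2 * ⨅ Q : Literature.MathematicalPhysics.StatisticalMechanics.PeriodicConfiguration 3, Q.energyPerParticle Literature.MathematicalPhysics.StatisticalMechanics.lennardJones) → ∃ P : Literature.MathematicalPhysics.StatisticalMechanics.PeriodicConfiguration 3, P.points = X ∧ IsLeast (Set.range fun Q : Literature.MathematicalPhysics.StatisticalMechanics.PeriodicConfiguration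 3 => Q.energyPerParticle Literature.MathematicalPhysics.StatisticalMechanics.lennardJones) (P.energyPerParticle Literature.MathematicalPhysics.StatisticalMechanics.lennardJones) := by
  sorry

/-- **STUB 4 — isolation of the periodic optimum modulo isometry** (= birth line `stub_minimisingCrystalsCountable`,
verbatim): the point sets of optimal periodic configurations are, modulo `s ↦ B s + t`, at most countably many.
Open in general (inside the hcp family: landed `tube_hcpE_unique_minimiser`); necessary for the crux. -/
theorem stub_minimisingCrystalsCountable :
    ∃ Y : ℕ → Set (EuclideanSpace ℝ (Fin 3)), ∀ Q : Literature.MathematicalPhysics.StatisticalMechanics.PeriodicConfiguration 3, Q.energyPerParticle Literature.MathematicalPhysics.StatisticalMechanics.lennardJones = (⨅ Q' : Literature.MathematicalPhysics.StatisticalMechanics.PeriodicConfiguration 3, Q'.energyPerParticle Literature.MathematicalPhysics.StatisticalMechanics.lennardJones) → ∃ n : ℕ, ∃ B : EuclideanSpace ℝ (Fin 3) →ₗᵢ[ℝ] EuclideanSpace ℝ (Fin 3), ∃ t : EuclideanSpace ℝ (Fin 3), Q.points = (fun s => B s + t) '' (Y n) := by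
  sorry

/-! ## §3 Name-keyed aliases (hypotheses of the composition)

The two SHARED stubs enter the composition under the names of the sibling route's items they coincide with
(`PerronTransitivity.NoFractionalGain`, `PerronTransitivity.UniformBindingRigidity` — registered obligations,
exactly as `Lines/hcp_transfer.lean` does with 9225/9226); the line-specific stubs under `Registered.stub_X`
(the statement of `stub_X` keyed by its registered name, as in `Lines/birth.lean`). -/
namespace Registered

/-- Statement of `stub_palmEnergyTransitive`, keyed by its registered name. -/
abbrev stub_palmEnergyTransitive : Prop :=
  ∀ δ : ℝ, 0 < δ → ∀ P : Measure (Measure (EuclideanSpace ℝ (Fin 3))), IsProbabilityMeasure P →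
    (∀ᵐ μ ∂P, IsRootedHardCore δ μ) → IsPointStationaryLaw P →
    (∫ μ, rootEnergy lennardJones μ ∂P) ≤ eStar → NoFractionalGain →
    ∀ᵐ μ ∂P, ∃ S : Set (EuclideanSpace ℝ (Fin 3)), (0 : EuclideanSpace ℝ (Fin 3)) ∈ S ∧
      (∀ p ∈ S, ∀ q ∈ S, p ≠ q → δ ≤ dist p q) ∧
      μ = (Measure.count : Measure (EuclideanSpace ℝ (Fin 3))).restrict S ∧
      ∀ p ∈ S, ∑' q : {q : EuclideanSpace ℝ (Fin 3) // q ∈ S ∧ q ≠ p}, lennardJones (dist p q.1) ≤ 2 * eStar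

/-- Statement of `stub_weightedClusterIneq`, keyed by its registered name. -/
abbrev stub_weightedClusterIneq : Prop :=
  Summit.AtomisticToContinuum.Crystallization.Theses.PerronTransitivity.NoFractionalGain → ∀ δ : ℝ, 0 < δ → ∀ S : Set (EuclideanSpace ℝ (Fin 3)), (∀ x ∈ S, ∀ y ∈ S, x ≠ y → δ ≤ dist x y) → ∀ c : EuclideanSpace ℝ (Fin 3) → ENNReal, (∀ x, c x ≤ 1) → ∀ (v : EuclideanSpace ℝ (Fin 3)) (R : ℝ), ∫⁻ y in Metric.ball v R, c y * (∫⁻ z, c z * ENNReal.ofReal (-Literature.MathematicalPhysics.StatisticalMechanics.lennardJones ‖z - y‖) ∂((MeasureTheory.Measure.count : MeasureTheory.Measure (EuclideanSpace ℝ (Fin 3))).restrict S)) ∂((MeasureTheory.Measure.count : MeasureTheory.Measure (EuclideanSpace ℝ (Fin 3))).restrict S) ≤ ∫⁻ y in Metric.ball v R, (c y * (∫⁻ z, c z * ENNReal.ofReal (Literature.MathematicalPhysics.StatisticalMechanics.lennardJones ‖z - y‖) ∂((MeasureTheory.Measure.count : MeasureTheory.Measure (EuclideanSpace ℝ (Fin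 3))).restrict S)) + 2 * ENNReal.ofReal (-(⨅ Q : Literature.MathematicalPhysics.StatisticalMechanics.PeriodicConfiguration 3, Q.energyPerParticle Literature.MathematicalPhysics.StatisticalMechanics.lennardJones)) * (c y) ^ 2 + c y * (∫⁻ z in (Metric.ball v R)ᶜ, c z * ENNReal.ofReal (-Literature.MathematicalPhysics.StatisticalMechanics.lennardJones ‖z - y‖) ∂((MeasureTheory.Measure.count : MeasureTheory.Measure (EuclideanSpace ℝ (Fin 3))).restrict S))) ∂((MeasureTheory.Measure.count : MeasureTheory.Measure (EuclideanSpace ℝ (Fin 3))).restrict S)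

/-- Statement of `stub_palmCopositivity`, keyed by its registered name. -/
abbrev stub_palmCopositivity : Prop :=
  (∀ δ : ℝ, 0 < δ → ∀ S : Set (EuclideanSpace ℝ (Fin 3)), (∀ x ∈ S, ∀ y ∈ S, x ≠ y → δ ≤ dist x y) → ∀ c : EuclideanSpace ℝ (Fin 3) → ENNReal, (∀ x, c x ≤ 1) → ∀ (v : EuclideanSpace ℝ (Fin 3)) (R : ℝ), ∫⁻ y in Metric.ball v R, c y * (∫⁻ z, c z * ENNReal.ofReal (-Literature.MathematicalPhysics.StatisticalMechanics.lennardJones ‖z - y‖) ∂((MeasureTheory.Measure.count : MeasureTheory.Measure (EuclideanSpace ℝ (Fin 3))).restrict S)) ∂((MeasureTheory.Measure.count : MeasureTheory.Measure (EuclideanSpace ℝ (Fin 3))).restrict S) ≤ ∫⁻ y in Metric.ball v R, (c y * (∫⁻ z, c z * ENNReal.ofReal (Literature.MathematicalPhysics.StatisticalMechanics.lennardJones ‖z - y‖) ∂((MeasureTheory.Measure.count : MeasureTheory.Measure (EuclideanSpace ℝ (Fin 3))).restrict S)) + 2 * ENNReal.ofReal (-(⨅ Q : Literature.MathematicalPhysics.StatisticalMechanics.PeriodicConfiguration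 3, Q.energyPerParticle Literature.MathematicalPhysics.StatisticalMechanics.lennardJones)) * (c y) ^ 2 + c y * (∫⁻ z in (Metric.ball v R)ᶜ, c z * ENNReal.ofReal (-Literature.MathematicalPhysics.StatisticalMechanics.lennardJones ‖z - y‖) ∂((MeasureTheory.Measure.count : MeasureTheory.Measure (EuclideanSpace ℝ (Fin 3))).restrict S))) ∂((MeasureTheory.Measure.count : MeasureTheory.Measure (EuclideanSpace ℝ (Fin 3))).restrict S)) → ∀ δ : ℝ, 0 < δ → ∀ P : MeasureTheory.Measure (MeasureTheory.Measure (EuclideanSpace ℝ (Fin 3))), MeasureTheory.IsProbabilityMeasure P → (∀ᵐ μ ∂P, Literature.Probability.Process.IsRootedHardCore δ μ) → Literature.Probability.Process.IsPointStationaryLaw P → ∀ w : MeasureTheory.Measure (EuclideanSpace ℝ (Fin 3)) → ENNReal, Measurable w → (∀ μ, w μ ≤ 1) → ∫⁻ μ, w μ * (∫⁻ z, w (MeasureTheory.Measure.map (fun x => x - z) μ) * ENNReal.ofReal (-Literature.MathematicalPhysics.StatisticalMechanics.lennardJones ‖z‖) ∂μ) ∂P ≤ ∫⁻ μ, w μ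 * (∫⁻ z, w (MeasureTheory.Measure.map (fun x => x - z) μ) * ENNReal.ofReal (Literature.MathematicalPhysics.StatisticalMechanics.lennardJones ‖z‖) ∂μ) ∂P + 2 * ENNReal.ofReal (-(⨅ Q : Literature.MathematicalPhysics.StatisticalMechanics.PeriodicConfiguration 3, Q.energyPerParticle Literature.MathematicalPhysics.StatisticalMechanics.lennardJones)) * ∫⁻ μ, (w μ) ^ 2 ∂P

/-- Statement of `stub_rootEnergyLeOfCopositivity`, keyed by its registered name. -/
abbrev stub_rootEnergyLeOfCopositivity : Prop :=
  ∀ δ : ℝ, 0 < δ → ∀ P : MeasureTheory.Measure (MeasureTheory.Measure (EuclideanSpace ℝ (Fin 3))), MeasureTheory.IsProbabilityMeasure P → (∀ᵐ μ ∂P, Literature.Probability.Process.IsRootedHardCore δ μ) → Literature.Probability.Process.IsPointStationaryLaw P → (∫ μ, Literature.MathematicalPhysics.StatisticalMechanics.rootEnergy Literature.MathematicalPhysics.StatisticalMechanics.lennardJones μ ∂P) ≤ (⨅ Q : Literature.MathematicalPhysics.StatisticalMechanics.PeriodicConfiguration 3, Q.energyPerParticle Literature.MathematicalPhysics.StatisticalMechanics.lennardJones)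 → (∀ w : MeasureTheory.Measure (EuclideanSpace ℝ (Fin 3)) → ENNReal, Measurable w → (∀ μ, w μ ≤ 1) → ∫⁻ μ, w μ * (∫⁻ z, w (MeasureTheory.Measure.map (fun x => x - z) μ) * ENNReal.ofReal (-Literature.MathematicalPhysics.StatisticalMechanics.lennardJones ‖z‖) ∂μ) ∂P ≤ ∫⁻ μ, w μ * (∫⁻ z, w (MeasureTheory.Measure.map (fun x => x - z) μ) * ENNReal.ofReal (Literature.MathematicalPhysics.StatisticalMechanics.lennardJones ‖z‖) ∂μ) ∂P + 2 * ENNReal.ofReal (-(⨅ Q : Literature.MathematicalPhysics.StatisticalMechanics.PeriodicConfiguration 3, Q.energyPerParticle Literature.MathematicalPhysics.StatisticalMechanics.lennardJones)) * ∫⁻ μ, (w μ) ^ 2 ∂P) → ∀ᵐ μ ∂P, Literature.MathematicalPhysics.StatisticalMechanics.rootEnergy Literature.MathematicalPhysics.StatisticalMechanics.lennardJones μ ≤ (⨅ Q : Literature.MathematicalPhysics.StatisticalMechanics.PeriodicConfiguration 3, Q.energyPerParticle Literature.MathematicalPhysics.StatisticalMechanics.lennardJones)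

/-- Statement of `stub_allSitesOfRoot`, keyed by its registered name. -/
abbrev stub_allSitesOfRoot : Prop :=
  ∀ δ : ℝ, 0 < δ → ∀ P : MeasureTheory.Measure (MeasureTheory.Measure (EuclideanSpace ℝ (Fin 3))), (∀ᵐ μ ∂P, Literature.Probability.Process.IsRootedHardCore δ μ) → Literature.Probability.Process.IsPointStationaryLaw P → (∀ᵐ μ ∂P, Literature.MathematicalPhysics.StatisticalMechanics.rootEnergy Literature.MathematicalPhysics.StatisticalMechanics.lennardJones μ ≤ (⨅ Q : Literature.MathematicalPhysics.StatisticalMechanics.PeriodicConfiguration 3, Q.energyPerParticle Literature.MathematicalPhysics.StatisticalMechanics.lennardJones)) → ∀ᵐ μ ∂P, ∃ S : Set (EuclideanSpace ℝ (Fin 3)), (0 : EuclideanSpace ℝ (Fin 3)) ∈ S ∧ (∀ p ∈ S, ∀ q ∈ S, p ≠ q → δ ≤ dist p q) ∧ μ = (MeasureTheory.Measure.count : MeasureTheory.Measure (EuclideanSpace ℝ (Fin 3))).restrict S ∧ ∀ p ∈ S, ∑' q : {q : EuclideanSpace ℝ (Fin 3) // q ∈ S ∧ q ≠ p}, Literature.MathematicalPhysics.StatisticalMechanics.lennardJones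 (dist p q.1) ≤ 2 * ⨅ Q : Literature.MathematicalPhysics.StatisticalMechanics.PeriodicConfiguration 3, Q.energyPerParticle Literature.MathematicalPhysics.StatisticalMechanics.lennardJones

/-- Statement of `stub_minimisingCrystalsCountable`, keyed by its registered name. -/
abbrev stub_minimisingCrystalsCountable : Prop :=
  ∃ Y : ℕ → Set (EuclideanSpace ℝ (Fin 3)), ∀ Q : PeriodicConfiguration 3,
    Q.energyPerParticle lennardJones = eStar →
    ∃ n : ℕ, ∃ B : EuclideanSpace ℝ (Fin 3) →ₗᵢ[ℝ] EuclideanSpace ℝ (Fin 3),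
      ∃ t : EuclideanSpace ℝ (Fin 3), Q.points = (fun s => B s + t) '' (Y n)

end Registered

-- the registered stubs inhabit the sibling items / their name-keyed statements (definitional unfolding only)
example : NoFractionalGain := stub_noFractionalGain
example : Registered.stub_palmEnergyTransitive := stub_palmEnergyTransitive
example : Registered.stub_weightedClusterIneq := stub_weightedClusterIneq
example : Registered.stub_palmCopositivity := stub_palmCopositivity
example : Registered.stub_rootEnergyLeOfCopositivity := stub_rootEnergyLeOfCopositivity
example : Registered.stub_allSitesOfRoot := stub_allSitesOfRoot
example : UniformBindingRigidity := stub_uniformBindingRigidity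
example : Registered.stub_minimisingCrystalsCountable := stub_minimisingCrystalsCountable
example : NoFractionalGain ↔ (∀ (N : ℕ) (x : Fin N → EuclideanSpace ℝ (Fin 3)), Function.Injective x → ∀ c : Fin N → ℝ, (∀ i, 0 ≤ c i) → 2 * (⨅ Q : Literature.MathematicalPhysics.StatisticalMechanics.PeriodicConfiguration 3, Q.energyPerParticle Literature.MathematicalPhysics.StatisticalMechanics.lennardJones) * ∑ i, c i ^ 2 ≤ ∑ i, ∑ j ∈ Finset.univ.erase i, c i * c j * Literature.MathematicalPhysics.StatisticalMechanics.lennardJones (dist (x i) (x j))) := Iff.rfl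
example : UniformBindingRigidity ↔ (∀ X : Set (EuclideanSpace ℝ (Fin 3)), X.Nonempty → (∃ δ : ℝ, 0 < δ ∧ ∀ p ∈ X, ∀ q ∈ X, p ≠ q → δ ≤ dist p q) → (∀ p ∈ X, ∑' q : {q : EuclideanSpace ℝ (Fin 3) // q ∈ X ∧ q ≠ p}, Literature.MathematicalPhysics.StatisticalMechanics.lennardJones (dist p q.1) ≤ 2 * ⨅ Q : Literature.MathematicalPhysics.StatisticalMechanics.PeriodicConfiguration 3, Q.energyPerParticle Literature.MathematicalPhysics.StatisticalMechanics.lennardJones) → ∃ P : Literature.MathematicalPhysics.StatisticalMechanics.PeriodicConfiguration 3, P.points = X ∧ IsLeast (Set.range fun Q : Literature.MathematicalPhysics.StatisticalMechanics.PeriodicConfiguration 3 => Q.energyPerParticle Literature.MathematicalPhysics.StatisticalMechanics.lennardJones) (P.energyPerParticle Literature.MathematicalPhysics.StatisticalMechanics.lennardJones)) := Iff.rfl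

/-! ## §4 Proved glue (sorry-free) -/

/-- **The Cantor–Bendixson seam**: a probability (outer) measure whose almost every point lies in a countable
union of sets charges one of them (no measurability needed). [folklore] -/
theorem exists_pos_measure_of_ae_mem_iUnion {α : Type*} [MeasurableSpace α] {P : Measure α}
    [IsProbabilityMeasure P] {s : ℕ → Set α} (h : ∀ᵐ x ∂P, x ∈ ⋃ n, s n) :
    ∃ n, 0 < P (s n) := by
  by_contra hne
  simp only [not_exists, not_lt] at hne
  have h0 : ∀ n, P (s n) = 0 := fun n => nonpos_iff_eq_zero.1 (hne n)
  have hU : P (⋃ n, s n) = 0 := measure_iUnion_null h0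
  have hc : P (⋃ n, s n)ᶜ = 0 := mem_ae_iff.1 h
  have h1 : P Set.univ ≤ 0 :=
    calc P Set.univ = P ((⋃ n, s n) ∪ (⋃ n, s n)ᶜ) := by rw [Set.union_compl_self]
      _ ≤ P (⋃ n, s n) + P (⋃ n, s n)ᶜ := measure_union_le _ _
      _ = 0 := by rw [hU, hc, add_zero]
  have h2 : P Set.univ = 0 := nonpos_iff_eq_zero.1 h1
  rw [measure_univ] at h2
  exact one_ne_zero h2

/-- `IsLeast` of the range pins the value to the infimum. [folklore] -/
theorem energy_eq_iInf_of_isLeast {Pc : PeriodicConfiguration 3}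
    (h : IsLeast (Set.range fun Q : PeriodicConfiguration 3 => Q.energyPerParticle lennardJones)
      (Pc.energyPerParticle lennardJones)) :
    Pc.energyPerParticle lennardJones = eStar := by
  haveI : Nonempty (PeriodicConfiguration 3) := ⟨Pc⟩
  exact le_antisymm (le_ciInf fun Q => h.2 ⟨Q, rfl⟩) (ciInf_le h.bddBelow Pc)

/-- **A rooted point set that is an isometric image of `Y` lies in the rooted class of `Y`**: if
`S = B '' Y + t` and `0 ∈ S` then `count|S ∈ cl(Y)` (root the copy at the preimage of `0`). [folklore] -/
theorem count_restrict_mem_rootedClass {S Y : Set (EuclideanSpace ℝ (Fin 3))}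
    (B : EuclideanSpace ℝ (Fin 3) →ₗᵢ[ℝ] EuclideanSpace ℝ (Fin 3)) (t : EuclideanSpace ℝ (Fin 3))
    (hS : S = (fun s => B s + t) '' Y) (h0 : (0 : EuclideanSpace ℝ (Fin 3)) ∈ S) :
    (Measure.count : Measure (EuclideanSpace ℝ (Fin 3))).restrict S ∈ rootedClass Y := by
  have h0' : (0 : EuclideanSpace ℝ (Fin 3)) ∈ (fun s => B s + t) '' Y := by rw [← hS]; exact h0
  obtain ⟨q, hq, hq0⟩ := h0'
  have hq0' : B q + t = 0 := hq0
  have ht : t = -B q := eq_neg_of_add_eq_zero_right hq0'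
  refine ⟨B, q, hq, ?_⟩
  rw [hS]
  congr 1
  refine Set.image_congr' fun s => ?_
  rw [ht, map_sub, sub_eq_add_neg]

/-- **`MinimisingLawsHaveAtoms_of`** — the three OPEN registered stubs (K* and M* by the names of the sibling items
`NoFractionalGain` stmt-15098 / `UniformBindingRigidity` stmt-15099 they coincide with, isolation by its registered
stub name) give the crux `MinimisingLawsHaveAtoms` BY NAME; the bridge (pieces 2a–2d, all LANDED) is discharged
inside the proof: fed with K* it makes almost every sample uniformly `2e*`-bound, M* makes it the rooted point set
of an optimal periodic configuration, isolation puts it in one of countably many rooted classes, and one class is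
charged. -/
theorem MinimisingLawsHaveAtoms_of (hK : NoFractionalGain) (hM : UniformBindingRigidity)
    (hC : Registered.stub_minimisingCrystalsCountable) : MinimisingLawsHaveAtoms := by
  have hB : Registered.stub_palmEnergyTransitive := stub_palmEnergyTransitive
  intro δ hδ P hP hhc hst hE
  haveI : IsProbabilityMeasure P := hP
  -- (1) bridge: a.s. the sample is a rooted, δ-separated, uniformly 2e*-bound point set
  have hae := hB δ hδ P hP hhc hst hE hK
  -- (2)+(3) minimax rigidity and isolation: a.s. the sample lies in one of countably many rooted classes
  obtain ⟨Y, hY⟩ := hC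
  have hcover : ∀ᵐ μ ∂P, μ ∈ ⋃ n, rootedClass (Y n) := by
    filter_upwards [hae] with μ hμ
    obtain ⟨S, h0, hsep, hμS, hbind⟩ := hμ
    obtain ⟨Pc, hpts, hleast⟩ := hM S ⟨0, h0⟩ ⟨δ, hδ, hsep⟩ hbind
    obtain ⟨n, B, t, hpts'⟩ := hY Pc (energy_eq_iInf_of_isLeast hleast)
    rw [hpts] at hpts'
    rw [hμS]
    exact Set.mem_iUnion.2 ⟨n, count_restrict_mem_rootedClass B t hpts' h0⟩
  -- (4) one of the countably many classes is charged
  obtain ⟨n, hn⟩ := exists_pos_measure_of_ae_mem_iUnion hcover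
  exact ⟨Y n, hn⟩

/-- Wiring check: the registered stubs feed the composition exactly as stated. -/
example : MinimisingLawsHaveAtoms :=
  MinimisingLawsHaveAtoms_of stub_noFractionalGain stub_uniformBindingRigidity stub_minimisingCrystalsCountable

end Summit.AtomisticToContinuum.Crystallization.Cruxes.MinimisingLawsHaveAtoms.PerronTransfer

end
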